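import Literature.MathematicalPhysics.QuantumFieldTheory.Balaban1983to89.Node00.TorusCoverCollarOfMeetsPrint

/-!
# NODE 00 — [15] (144) «□̃ ⊂ Ω_{j−1}» FOR A PRINT DATUM WHOSE **BOX** (not its grid cube) COMES WITHIN `Dw` OF `Ω_j`: the collar clause `hcollar` of the (152)∕(153) door in
# the BOX-FORM meeting premise of the level-raising reduction (dag-n07-e MODULE 56 `N07SplitClauseLevelRaising.datumGaugeSplitTopStepCoreG_of_clean`)

Cell `pub-ymgap`, seat `pub-ymgap-dag-n07-e` g22 (node N07 = [15] = [Balaban1985Variational]; lane owner of the K0 road), MODULE 57a (cell bus, LOCATED-INWARD-DATUM follow-up).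
`--kind proof --supports stmt-QuantumFields-20541`; count-neutral; theorems only, no `def`.  [6] = [Balaban1985RegularSpaces], [III] = [Balaban1988Convergent].
The BOX-FORM twin of dag-n07-w4 g3's `Node00.TorusCoverCollarOfMeetsPrint` (p612582 ∕ v1.1), CONSUMED BY NAME (nothing restated): its three collar theorems take a point `x` of the
GRID CUBE `cubeExt (LⁿM) a 0` within `Dw` of a lift of a site of `Ω_n`; here `x` is any point of the PRINT BOX `box L (cornerP M ρ a) (sideP M ρ) n` ⊇ that grid cube.

WHY.  The level-raising reduction (MODULE 56, p639318) serves an inward datum `(j, a)` from a parent datum `(j+1, a⁺)` whose print box contains the child's; the parent's GRID CUBE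
need not come near `Ω_{j+1}` (print boxes have no lower collar: `cornerP = ρ·⌊M a∕ρ⌋`), only its BOX does (it contains the child's inward point).  So the clean-datum clause the
head's knit owes (FILE 7) carries the meeting premise ON THE BOX — `∃ x ∈ box …, ∃ y, π y ∈ Ω_n ∧ Within 3 x y` — and the S3 door's collar hypothesis must follow from it.  It does,
WITH THE SAME FLOOR `(11d + 4ρ + M + Dw)·L ≤ M₁`: every point of the member `𝔔̃ = tcube L (cornerP) (sideP) ρ n` lies within `Lⁿ(sideP + 2ρ) − 1 ≤ (11d + 4ρ)Lⁿ + (LⁿM − 1)` of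
ANY point of the box (36a `sideP_le`: `sideP ≤ M + 11d + 2ρ`) — exactly the reach dag-n07-w4's core-form lemma uses — so the three theorems hold verbatim with `x ∈ box`.

CONTENTS.  §1 `within_of_mem_tcube_of_mem_box` (pure box arithmetic), `within_of_mem_box_of_mem_box`, ★ `within_of_mem_Ω_cubeIdxP'_of_within_box` (the reach, in the core-form
lemma's shape); §2 ★ `Sect2.cover_image_Ω_cubeIdxP'_subset_of_within_mem_box` (`2 ≤ n ≤ k`) · ★ `Sect2.cover_image_Ω_cubeIdxP'_one_subset_hullD_of_within_mem_box` (`n = 1`) ·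
★★ `Sect2.hcollar_cubeIdxP'_of_within_mem_box` (both cases, the door's shape, floor `(11d + 4ρ + M + Dw)·L ≤ M₁`) · ★ `Sect2.cover_mem_Ω_pred_of_near_box_propCubeP_box` (v1.1 §3's
margin twin, floor `11d + 2ρ + M + Dw + E ≤ M₁`).

HONEST FRAMING: integer bookkeeping on box coordinates + print's separation by name; nothing of [15]∕[6] asserted; [6] Prop. 6 stays a displayed HYPOTHESIS elsewhere; no token
discharged; stub 1-G ∕ K0⁷ ∕ K1⁹ NOT closed; N07 NOT discharged; counts unmoved (typed 28∕28 · discharged 5∕27); one finite 𝕋⁴ programme at fixed ε — R4 closes the conditional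
finite-𝕋⁴ rung `BalabanLadder.UV` ONLY; the YM mass gap (Clay) is NOT proved by any of this; nothing continuum ∕ ℝ⁴ ∕ OS.  No `def`, no `instance`, no `notation`, no `sorry`.
-/

noncomputable section

namespace Literature.MathematicalPhysics.QuantumFieldTheory.Balaban1983to89.Node00

open B15Eq112TorusCover (cover)
open B14DomainGeom (Pt Within)
open B14.Eq213MaximalDomains (side cubeExt)
open B8Eq131Cubes (box tcube bLo bHi tLo tHi)
open B8Ineq130 (tlo thi tlo_apply thi_apply)

variable {P : Params}

/-! ## §1  The reach of the member from a point of the box -/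

section Reach

variable {d : ℕ}

/-- **A POINT OF THE COLLARED CUBE IS WITHIN `Lⁿ(S + 2ρ) − 1` OF ANY POINT OF THE BOX**: `tcube L c S ρ n = [Lⁿ(c − 2ρ), Lⁿ(c + S + 2ρ) − 1]`,
`box L c S n = [Lⁿc, Lⁿ(c + S) − 1]` coordinatewise. [cite: Balaban1985RegularSpaces, p.98 («a cube which we denote by □̃ … distance … 2R₁M₁»; bookkeeping)] -/
theorem within_of_mem_tcube_of_mem_box (L : ℕ) {c : Pt d} {S ρ n : ℕ} {z x : Pt d} (hz : z ∈ tcube L c S ρ n) (hx : x ∈ box L c S n) :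
    Within ((L : ℤ) ^ n * ((S : ℤ) + 2 * (ρ : ℤ)) - 1) z x := by
  intro i
  obtain ⟨hzl, hzu⟩ := hz i
  obtain ⟨hxl, hxu⟩ := hx i
  rw [tlo_apply] at hzl
  rw [thi_apply] at hzu
  simp only [tLo, tHi, bLo, bHi, Nat.cast_zero, sub_zero, add_zero] at hzl hzu hxl hxu
  have hL : (0 : ℤ) ≤ (L : ℤ) ^ n := by positivity
  rw [abs_le]
  constructor <;> nlinarith

/-- Two points of one box are within `LⁿS − 1` of each other. [cite: Balaban1985RegularSpaces, p.98 (bookkeeping)] -/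
theorem within_of_mem_box_of_mem_box (L : ℕ) {c : Pt d} {S n : ℕ} {z x : Pt d} (hz : z ∈ box L c S n) (hx : x ∈ box L c S n) :
    Within ((L : ℤ) ^ n * (S : ℤ) - 1) z x := by
  intro i
  obtain ⟨hzl, hzu⟩ := hz i
  obtain ⟨hxl, hxu⟩ := hx i
  simp only [bLo, bHi, Nat.cast_zero, sub_zero, add_zero] at hzl hzu hxl hxu
  rw [abs_le]
  constructor <;> nlinarith

end Reach

/-- ★ **THE REACH OF THE PRINT MEMBER FROM A BOX WITNESS** (the core-form lemma's bound, from a point of the BOX): every point `z` of any level `(cubeIdxP' P n _ M ρ a).Ω j`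
(= `𝔔̃ = tcube L (cornerP) (sideP) ρ n`, 36a `cubeIdxP'_Ω`) lies within `(11d + 4ρ)·Lⁿ + (LⁿM − 1) + Dw` of any `y` within `Dw` of a point `x` of the print box — since
`Lⁿ(sideP + 2ρ) − 1 ≤ (11d + 4ρ)Lⁿ + LⁿM − 1` by `sideP ≤ M + 11d + 2ρ`. [cite: Balaban1985Variational, (144) p.300; Balaban1985RegularSpaces, p.98] -/
theorem within_of_mem_Ω_cubeIdxP'_of_within_box {n : ℕ} (hn : 1 ≤ n) {M ρ : ℕ} {a x y : Pt P.d}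
    (hx : x ∈ box P.L (cornerP P M ρ a) (sideP P M ρ) n) {Dw : ℕ} (hxy : Within (Dw : ℤ) x y) {j : ℕ} {z : Pt P.d} (hz : z ∈ (cubeIdxP' P n hn M ρ a).Ω j) :
    Within ((((11 * P.d + 4 * ρ) * P.L ^ n : ℕ) : ℤ) + (((side P.L M n : ℕ) : ℤ) - 1) + (Dw : ℤ)) z y := by
  rw [cubeIdxP'_Ω] at hz
  refine ((within_of_mem_tcube_of_mem_box P.L hz hx).mono ?_).triangle hxy
  have hS : ((sideP P M ρ : ℕ) : ℤ) ≤ M + 11 * P.d + 2 * ρ := by exact_mod_cast sideP_le (P := P) M ρ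
  have hL : (0 : ℤ) ≤ (P.L : ℤ) ^ n := by positivity
  rw [side]
  push_cast
  nlinarith

/-! ## §2  The collar clause of the (152)∕(153) door from a box witness, both cases -/

/-- ★ **[15] (144) «□̃ ⊂ Ω_{j−1}» FOR A PRINT DATUM WHOSE BOX COMES WITHIN `Dw` OF `Ω_n`, `2 ≤ n ≤ k`** (dag-n07-w4's `Sect2.cover_image_Ω_cubeIdxP'_subset_of_within_mem` with the
witness `x` in the BOX): for a separated sequence, a point `x` of `box L (cornerP M ρ a) (sideP M ρ) n` within `Dw` of a lift `y` of a site of `Ω_n`, and the floor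
`11d + 4ρ + M + Dw ≤ M₁`, every level of the print member projects into `Ω_{n−1}`. [cite: Balaban1985Variational, (144) p.300, p.302; Balaban1985RegularSpaces, p.98, (1.3)–(1.6) p.77; Balaban1988Convergent, (2.13) p.256] -/
theorem Sect2.cover_image_Ω_cubeIdxP'_subset_of_within_mem_box {D : ℕ → Set (Set (Site P 0))} {k M₁ : ℕ} (hM₁ : 1 ≤ M₁) (s : B14.Eq218Concrete.Seq D k)
    (hsep : Sect2.SeqSeparated M₁ s) {ρ M : ℕ} {Dw : ℕ} (hfloor : 11 * P.d + 4 * ρ + M + Dw ≤ M₁) {n : ℕ} (hn : 2 ≤ n)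
    (hnk : n ≤ k) {a x y : Pt P.d} (hx : x ∈ box P.L (cornerP P M ρ a) (sideP P M ρ) n) (hy : cover P y ∈ s.Ω n) (hxy : Within (Dw : ℤ) x y) (j : ℕ) :
    cover P '' (cubeIdxP' P n (by omega) M ρ a).Ω j ⊆ s.Ω (n - 1) := by
  rintro _ ⟨z, hz, rfl⟩
  have hw := within_of_mem_Ω_cubeIdxP'_of_within_box (by omega) hx hxy hz
  obtain ⟨m, rfl⟩ : ∃ m, n = m + 1 := ⟨n - 1, by omega⟩
  rw [Nat.add_sub_cancel]
  refine cover_mem_of_within_of_seqSeparated hM₁ s hsep (by omega) (by omega) hy (hw.mono ?_)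
  rw [side, side]
  have hL : (1 : ℤ) ≤ (P.L : ℤ) ^ (m + 1) := by exact_mod_cast Nat.one_le_pow _ _ P.L_pos
  have hf : ((11 * P.d + 4 * ρ + M + Dw : ℕ) : ℤ) ≤ M₁ := by exact_mod_cast hfloor
  push_cast at hf ⊢
  nlinarith

/-- ★ **AT SCALE `n = 1` THE MEMBER OF A PRINT DATUM WHOSE BOX MEETS `Ω₁` WITHIN `Dw` PROJECTS INTO THE SUPPORT** `hullD P M₁ 1 (Ω 1)` ([III] p. 255), floor
`(11d + 4ρ + M)·L + Dw ≤ M₁` (dag-n07-w4's `…_one_subset_hullD_of_within_mem` with `x` in the box). [cite: Balaban1988Convergent, p.255, (2.13) p.256; Balaban1985Variational, (144) p.300; Balaban1985RegularSpaces, p.98] -/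
theorem Sect2.cover_image_Ω_cubeIdxP'_one_subset_hullD_of_within_mem_box {M₁ ρ : ℕ} {Ω : ℕ → Set (Site P 0)} {M : ℕ} (hM : 1 ≤ M) {Dw : ℕ}
    (hfloor : (11 * P.d + 4 * ρ + M) * P.L + Dw ≤ M₁) {a x y : Pt P.d} (hx : x ∈ box P.L (cornerP P M ρ a) (sideP P M ρ) 1) (hy : cover P y ∈ Ω 1)
    (hxy : Within (Dw : ℤ) x y) (j : ℕ) :
    cover P '' (cubeIdxP' P 1 le_rfl M ρ a).Ω j ⊆ hullD P M₁ 1 (Ω 1) := by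
  rintro _ ⟨z, hz, rfl⟩
  have hw := within_of_mem_Ω_cubeIdxP'_of_within_box le_rfl hx hxy hz
  have hM₁ : 0 < M₁ := by
    have h1 : 1 ≤ (11 * P.d + 4 * ρ + M) * P.L := Nat.one_le_iff_ne_zero.mpr (Nat.mul_ne_zero (by omega) (by have := P.hL.2; omega))
    omega
  refine cover_mem_hullD_one_of_within hM₁ hy (hw.mono ?_)
  rw [side, pow_one]
  have hf : (((11 * P.d + 4 * ρ + M) * P.L + Dw : ℕ) : ℤ) ≤ M₁ := by exact_mod_cast hfloor
  push_cast at hf ⊢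
  nlinarith

/-- ★★ **THE COLLAR CLAUSE OF THE (152)∕(153) DOOR FROM A BOX WITNESS, IN THE DOOR'S OWN SHAPE**: for `1 ≤ n ≤ k`, a separated sequence, a print datum of level `n` whose BOX
has a point within `Dw` of a lift of a site of `Ω_n`, and the single floor `(11d + 4ρ + M + Dw)·L ≤ M₁` (the SAME floor as dag-n07-w4's grid-cube form), the level-`0` set of
the print member projects into `Ω_{n−1}` for `n ≥ 2` and into the support `hullD P M₁ 1 (Ω 1)` for `n = 1` — the hypothesis `hcollar` of n07-w3's
`exists_localGauge152_RE153_coverBox_propCubeP_of_prop6P` at every CLEAN datum of the level-raising reduction (whose meeting premise is on the box).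
[cite: Balaban1985Variational, (144) p.300 («a cube □ intersecting Ω_j»), (152) p.301, p.302; Balaban1985RegularSpaces, p.98, Prop. 6 p.99; Balaban1988Convergent, p.255, (2.13) p.256] -/
theorem Sect2.hcollar_cubeIdxP'_of_within_mem_box {D : ℕ → Set (Set (Site P 0))} {k M₁ : ℕ} (hM₁ : 1 ≤ M₁) (s : B14.Eq218Concrete.Seq D k)
    (hsep : Sect2.SeqSeparated M₁ s) {ρ M : ℕ} (hM : 1 ≤ M) {Dw : ℕ} (hfloor : (11 * P.d + 4 * ρ + M + Dw) * P.L ≤ M₁) {n : ℕ} (hn : 1 ≤ n)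
    (hnk : n ≤ k) {a x y : Pt P.d} (hx : x ∈ box P.L (cornerP P M ρ a) (sideP P M ρ) n) (hy : cover P y ∈ s.Ω n) (hxy : Within (Dw : ℤ) x y) :
    cover P '' (cubeIdxP' P n hn M ρ a).Ω 0 ⊆ (if n - 1 = 0 then hullD P M₁ 1 (s.Ω 1) else s.Ω (n - 1)) := by
  rcases Nat.eq_or_lt_of_le hn with h1 | h1
  · subst h1
    rw [if_pos rfl]
    refine Sect2.cover_image_Ω_cubeIdxP'_one_subset_hullD_of_within_mem_box hM ?_ hx hy hxy 0
    have : Dw ≤ Dw * P.L := Nat.le_mul_of_pos_right Dw P.L_pos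
    nlinarith
  · rw [if_neg (by omega)]
    refine Sect2.cover_image_Ω_cubeIdxP'_subset_of_within_mem_box hM₁ s hsep ?_ h1 hnk hx hy hxy 0
    exact le_trans (Nat.le_mul_of_pos_right _ P.L_pos) hfloor

/-- ★ **THE MARGIN TWIN FROM A BOX WITNESS** (dag-n07-w4's v1.1 `Sect2.cover_mem_Ω_pred_of_near_box_propCubeP` with `x` in the box): every point within `E·Lⁿ` of the print box of a
level-`n` datum (`2 ≤ n ≤ k`) whose box has a point within `Dw` of a lift of a site of `Ω_n` projects into `Ω_{n−1}`, floor `11d + 2ρ + M + Dw + E ≤ M₁` (two box points are within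
`Lⁿ·sideP − 1 ≤ (M + 11d + 2ρ)Lⁿ − 1`). [cite: Balaban1985Variational, (144) p.300, (150) p.301; Balaban1985RegularSpaces, p.98, (1.3)–(1.6) p.77; Balaban1988Convergent, (2.13) p.256] -/
theorem Sect2.cover_mem_Ω_pred_of_near_box_propCubeP_box {D : ℕ → Set (Set (Site P 0))} {k M₁ : ℕ} (hM₁ : 1 ≤ M₁) (s : B14.Eq218Concrete.Seq D k)
    (hsep : Sect2.SeqSeparated M₁ s) {ρ M : ℕ} {Dw E : ℕ} (hfloor : 11 * P.d + 2 * ρ + M + Dw + E ≤ M₁) {n : ℕ} (hn : 2 ≤ n)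
    (hnk : n ≤ k) {a x y : Pt P.d} (hx : x ∈ box P.L (cornerP P M ρ a) (sideP P M ρ) n) (hy : cover P y ∈ s.Ω n) (hxy : Within (Dw : ℤ) x y) {z y' : Pt P.d}
    (hy' : y' ∈ box P.L (cornerP P M ρ a) (sideP P M ρ) n) (hz : Within (((E * P.L ^ n : ℕ) : ℤ)) z y') : cover P z ∈ s.Ω (n - 1) := by
  have hw := (hz.triangle (within_of_mem_box_of_mem_box P.L hy' hx)).triangle hxy
  obtain ⟨m, rfl⟩ : ∃ m, n = m + 1 := ⟨n - 1, by omega⟩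
  rw [Nat.add_sub_cancel]
  refine cover_mem_of_within_of_seqSeparated hM₁ s hsep (by omega) (by omega) hy (hw.mono ?_)
  rw [side]
  have hS : ((sideP P M ρ : ℕ) : ℤ) ≤ M + 11 * P.d + 2 * ρ := by exact_mod_cast sideP_le (P := P) M ρ
  have hL : (1 : ℤ) ≤ (P.L : ℤ) ^ (m + 1) := by exact_mod_cast Nat.one_le_pow _ _ P.L_pos
  have hf : ((11 * P.d + 2 * ρ + M + Dw + E : ℕ) : ℤ) ≤ M₁ := by exact_mod_cast hfloor
  push_cast at hf ⊢
  nlinarith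

end Literature.MathematicalPhysics.QuantumFieldTheory.Balaban1983to89.Node00

end
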